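import Summits.CriticalPhenomena.PercolationContinuityZ3.Theorems.PercNearOneGluingAdditiveGluingDKernelInterp
import HarnessLib

/-! # Crux `PercNearOneGluing.AdditiveGluing` (stmt-CriticalPhenomena-4576) — PINNING for the designated-pocket kernel: the designated
# relay's own pairs into the block are irrelevant (seat (d) round 4)

Support file (`--supports stmt-CriticalPhenomena-4576`); no definitions, no named facts.

For a pair `e = s(a₀, s₁)` joining the designation `a₀` to a block vertex `s₁ ∈ S` (`a₀ ∉ S`): `D(u[e↦0], S, a₀) → D(u, S, a₀)`
(`dKernel_pin`).  By the exact interpolation `dKernel_interp` it suffices to treat the sure side `u[e↦1]`, where `a₀` and `s₁` are almost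
surely one cluster, so `μ(a₀ ↔ b) = μ(s₁ ↔ b)` (`dpin_real_openConn_eq_of_sure`) and the Lemma-5 leaf `dKernel_of_leaf` applies with
equality.  This is the D-kernel form of gen-0's `kernelPin_slack_eq` (one pair at a time) and the mechanism behind the zero-margin
certificates found by this seat's adversarial search: delete `a₀`'s pairs into `S`; if `a₀` is still the minimiser, the induction hypothesis
closes the block.  [cite: KozmaNitzan2024, §3.2 proof of Thm 5 p. 14 ("no big difference between conditioning on σ_{x} and deleting 0"), Lemma 5 p. 13]
-/

namespace Summit.CriticalPhenomena.PercolationContinuityZ3.Theorems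

open MeasureTheory Set
open Literature.Probability.LatticeModels (prodBernoulli)
open Literature.Probability.Percolation (BondConfig openConn openConnIn openGraph openCluster)
open scoped BigOperators

noncomputable section
open Classical

section DKernelPin

open Literature.Probability.LatticeModels Literature.Probability.Percolation

variable {n : ℕ}

/-- If the pair `s(x, y)` is sure, `x` and `y` have the same two-point function to any `b`. [folklore] -/
theorem dpin_real_openConn_eq_of_sure (w : Sym2 (Fin n) → unitInterval) (x y b : Fin n) (hxy : x ≠ y)
    (hw : w s(x, y) = 1) :
    (prodBernoulli w).real (openConn x b) = (prodBernoulli w).real (openConn y b) := by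
  refine edgeSw_real_eq_of_sure w s(x, y) hw _ _ fun ω he => ?_
  have hadj : ω ∈ (openConn x y : Set (BondConfig (Fin n))) :=
    (SimpleGraph.Adj.reachable ((openGraph_adj ω x y).2 ⟨he, hxy⟩) : (openGraph ω).Reachable x y)
  exact ⟨fun h => blockGrowth_openConn_trans (blockGrowth_openConn_symm hadj) h,
    fun h => blockGrowth_openConn_trans hadj h⟩

/-- **Pinning for the D-kernel**: for `e = s(a₀, s₁)` with `s₁ ∈ S ∌ a₀` (and `b ∉ S`), `D(u[e↦0], S, a₀) → D(u, S, a₀)`.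
[cite: KozmaNitzan2024, §3.2 p. 14, Lemma 5 p. 13] -/
theorem dKernel_pin (u : Sym2 (Fin n) → unitInterval) (A S : Finset (Fin n)) (b a₀ s₁ : Fin n)
    (hs₁ : s₁ ∈ S) (ha₀S : a₀ ∉ S) (hbS : b ∉ S)
    (h0 : (prodBernoulli (fun e' : Sym2 (Fin n) => if (∀ y ∈ e', y ∈ S) ∧ ¬ e'.IsDiag then 1 else Function.update u s(a₀, s₁) 0 e')).real
          ((⋃ v ∈ S, ⋃ a ∈ A, openConn v a) ∩ openConn a₀ b)
        ≤ (prodBernoulli (fun e' : Sym2 (Fin n) => if (∀ y ∈ e', y ∈ S) ∧ ¬ e'.IsDiag then 1 else Function.update u s(a₀, s₁) 0 e')).real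
          (⋃ v ∈ S, openConn v b)) :
    (prodBernoulli (fun e' : Sym2 (Fin n) => if (∀ y ∈ e', y ∈ S) ∧ ¬ e'.IsDiag then 1 else u e')).real
        ((⋃ v ∈ S, ⋃ a ∈ A, openConn v a) ∩ openConn a₀ b)
      ≤ (prodBernoulli (fun e' : Sym2 (Fin n) => if (∀ y ∈ e', y ∈ S) ∧ ¬ e'.IsDiag then 1 else u e')).real
        (⋃ v ∈ S, openConn v b) := by
  have ha₀s : a₀ ≠ s₁ := fun h => ha₀S (h ▸ hs₁)
  refine dKernel_interp u A S b a₀ s(a₀, s₁) h0 ?_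
  -- the sure side: `a₀` is a leaf with equality
  refine dKernel_of_leaf (Function.update u s(a₀, s₁) 1) A S b a₀ s₁ hs₁ hbS (le_of_eq ?_)
  exact dpin_real_openConn_eq_of_sure _ a₀ s₁ b ha₀s (Function.update_self _ _ _)

end DKernelPin

end

end Summit.CriticalPhenomena.PercolationContinuityZ3.Theorems
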